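import Summits.Ventures.CertifiedArithmetic.LowPrec.ErrorFreeAdd
import Summits.Ventures.CertifiedArithmetic.LowPrec.AccumulateSharp

/-!
# Neumaier's compensated summation in a minifloat format: `|res - s| ≤ u|s| + n(n-1)u²·Σ|xᵢ|`

HONEST FRAMING (venture CertifiedArithmetic / cell `pub-lowprec`): certified error envelopes and
provably optimal rounding/accumulation schemes for low-precision formats under stated cost models;
every table by two implementations; no hardware or vendor claims.

The compensated recursive summation of Kahan–Babuška in NEUMAIER's variant [Neumaier1974]
(= `kbn` of the cell's GEMM model, [BoldoEtAl2023, §5.3]): `ŝ₀ = x₀`, `c₀ = 0`, and for each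
further summand `t = fl(ŝ + x)`, `e = fl(fl(ŝ - t) + x)` if `|x| ≤ |ŝ|` else `fl(fl(x - t) + ŝ)`,
`c ← fl(c + e)`, `ŝ ← t`; result `res = fl(ŝₙ + cₙ)`; every operation one rounding `fl = roundNE α`.
PROVED here for every format `α` with `emaxCode ≥ 2`, summands `x₀ … xₙ ∈ F_α`, no chain sum out of
range (the cell's `FIN` regime):
* (i) every correction is the exact local error, `eₖ = ŝₖ₋₁ + xₖ - ŝₖ ∈ F_α` (`kbnCorr_eq`, by
  Fast2Sum, `ErrorFreeAdd.lean` — this part needs NO range hypothesis);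
* (ii) `ŝₙ + Σ eₖ = Σ xᵢ` exactly (`kbn_fst_add_sum_corr`);
* (iii) `Σ|eₖ| ≤ n·u/(1+u)·Σ|xᵢ|` and (iv) `|cₙ - Σ eₖ| ≤ (n-1)·u/(1+u)·Σ|eₖ|`, both by the
  Jeannerod–Rump any-order theorem for the format (`AccumulateSharp.lean`) applied to the two chains;
* (v) `|res - s| ≤ u'|s| + (1+u')·n(n-1)·u'²·Σ|xᵢ|`, `u' = u/(1+u)` (`abs_kbnSum_sub_sum_le_sharp`),
  hence `|res - s| ≤ u|s| + n(n-1)u²·Σ|xᵢ|` for `n + 1` summands, with NO condition `nu < 1`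
  (`abs_kbnSum_sub_sum_le`) — which implies the classical second-order envelope
  `u|s| + γₙ² Σ|xᵢ|` [OgitaRumpOishi2005, Prop. 4.5 shape; BoldoEtAl2023, §5.3] and the cell's
  GEMM-note Prop. kbn. The constant `n(n-1)` (two sharp first-order factors) is ours.
-/

namespace Literature.ComputerArithmetic.FloatingPoint

namespace MiniFloat

open Finset
open Literature.ComputerArithmetic.JeannerodRump2018
open Literature.ComputerArithmetic.JeannerodRump2018.SumTree

variable {α : Format}

/-! ### The algorithm -/

/-- Neumaier's compensated summation in format `α` (every operation `fl = roundNE α`): the state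
`(ŝₖ, cₖ)` after the summands `x 0, …, x k` — `ŝ₀ = fl(x₀)`, `c₀ = 0`; `ŝₖ₊₁ = fl(ŝₖ + xₖ₊₁)`,
`cₖ₊₁ = fl(cₖ + eₖ₊₁)` with the branch-selected Fast2Sum correction `eₖ₊₁`.
[cite: BoldoEtAl2023, §5.3 (Neumaier1974)] -/
def kbn (α : Format) (x : ℕ → ℚ) : ℕ → ℚ × ℚ
  | 0 => (flα α (x 0), 0)
  | k + 1 =>
      (flα α ((kbn α x k).1 + x (k + 1)),
       flα α ((kbn α x k).2 +
         (if |x (k + 1)| ≤ |(kbn α x k).1| then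
            flα α (flα α ((kbn α x k).1 - flα α ((kbn α x k).1 + x (k + 1))) + x (k + 1))
          else
            flα α (flα α (x (k + 1) - flα α ((kbn α x k).1 + x (k + 1))) + (kbn α x k).1))))

/-- The correction term `eₖ₊₁` of step `k + 1`: `fl(fl(ŝₖ - t) + xₖ₊₁)` if `|xₖ₊₁| ≤ |ŝₖ|`, else
`fl(fl(xₖ₊₁ - t) + ŝₖ)`, where `t = fl(ŝₖ + xₖ₊₁)`. [cite: BoldoEtAl2023, §5.3 (Neumaier1974)] -/
def kbnCorr (α : Format) (x : ℕ → ℚ) (k : ℕ) : ℚ :=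
  if |x (k + 1)| ≤ |(kbn α x k).1| then
    flα α (flα α ((kbn α x k).1 - flα α ((kbn α x k).1 + x (k + 1))) + x (k + 1))
  else
    flα α (flα α (x (k + 1) - flα α ((kbn α x k).1 + x (k + 1))) + (kbn α x k).1)

/-- The delivered result after `x 0, …, x n`: `res = fl(ŝₙ + cₙ)`. [cite: Neumaier1974] -/
def kbnSum (α : Format) (x : ℕ → ℚ) (n : ℕ) : ℚ := flα α ((kbn α x n).1 + (kbn α x n).2)

/-- Step equations. [folklore] -/
theorem kbn_succ (x : ℕ → ℚ) (k : ℕ) : kbn α x (k + 1)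
    = (flα α ((kbn α x k).1 + x (k + 1)), flα α ((kbn α x k).2 + kbnCorr α x k)) := rfl

/-- The running sum is always a value of `α` (it is a rounding). [folklore] -/
theorem exists_toRat_eq_kbn_fst (x : ℕ → ℚ) : ∀ k, ∃ y : MiniFloat α, y.toRat = (kbn α x k).1
  | 0 => ⟨roundNE α (x 0), rfl⟩
  | _ + 1 => ⟨roundNE α _, rfl⟩

/-- The running compensation is always a value of `α`. [folklore] -/
theorem exists_toRat_eq_kbn_snd (x : ℕ → ℚ) : ∀ k, ∃ y : MiniFloat α, y.toRat = (kbn α x k).2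
  | 0 => ⟨zero α, by simp [kbn]⟩
  | _ + 1 => ⟨roundNE α _, rfl⟩

/-- Every correction term is a value of `α` (it is a rounding). [folklore] -/
theorem exists_toRat_eq_kbnCorr (x : ℕ → ℚ) (k : ℕ) : ∃ y : MiniFloat α, y.toRat = kbnCorr α x k := by
  unfold kbnCorr; split <;> exact ⟨roundNE α _, rfl⟩

/-! ### (i) The corrections are the exact local errors (Fast2Sum) -/

/-- (i) EXACT CORRECTIONS: if `xₖ₊₁ ∈ F_α` then `eₖ₊₁ = ŝₖ + xₖ₊₁ - ŝₖ₊₁` exactly — in either branch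
of the magnitude test, with no range hypothesis (Fast2Sum is an EFT under saturation,
`fast2Sum_exact'`). [cite: BoldoMelquiond2017, Thm 5.6; Neumaier1974] -/
theorem kbnCorr_eq (x : ℕ → ℚ) (k : ℕ) (hxk : ∃ y : MiniFloat α, y.toRat = x (k + 1)) :
    kbnCorr α x k = (kbn α x k).1 + x (k + 1) - (kbn α x (k + 1)).1 := by
  obtain ⟨a, ha⟩ := exists_toRat_eq_kbn_fst (α := α) x k
  obtain ⟨b, hb⟩ := hxk
  rw [kbn_succ]
  unfold kbnCorr flα
  rw [← ha, ← hb]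
  split
  · rename_i h
    exact fast2Sum_exact' a b h
  · rename_i h
    have h' : |a.toRat| ≤ |b.toRat| := (not_le.mp h).le
    have := fast2Sum_exact' b a h'
    rw [add_comm b.toRat a.toRat] at this
    rw [this]

/-! ### (ii) Telescoping -/

/-- (ii) `ŝₙ + Σ_{k<n} eₖ₊₁ = Σ_{i≤n} xᵢ` exactly, for summands in `F_α`. [cite: Neumaier1974] -/
theorem kbn_fst_add_sum_corr (x : ℕ → ℚ) :
    ∀ n, (∀ i ≤ n, ∃ y : MiniFloat α, y.toRat = x i) →
      (kbn α x n).1 + ∑ k ∈ range n, kbnCorr α x k = ∑ i ∈ range (n + 1), x i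
  | 0, hx => by
      simp only [kbn, range_zero, sum_empty, add_zero, zero_add, range_one, sum_singleton]
      exact toRat_roundNE_of_exists (hx 0 le_rfl)
  | n + 1, hx => by
      have ih := kbn_fst_add_sum_corr x n (fun i hi => hx i (Nat.le_succ_of_le hi))
      rw [sum_range_succ, sum_range_succ (fun i => x i), ← ih,
        kbnCorr_eq x n (hx (n + 1) le_rfl)]
      ring

/-! ### The two recursive chains as evaluation trees -/

/-- The left-comb (sequential) evaluation tree over `v 0, …, v k`. [folklore] -/
def combTree (v : ℕ → ℚ) : ℕ → SumTree
  | 0 => .leaf (v 0)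
  | k + 1 => .node (combTree v k) (.leaf (v (k + 1)))

/-- The comb has `k + 1` leaves. [folklore] -/
theorem length_leaves_combTree (v : ℕ → ℚ) : ∀ k, (combTree v k).leaves.length = k + 1
  | 0 => rfl
  | k + 1 => by simp [combTree, SumTree.leaves, length_leaves_combTree v k]

/-- `Σ|leaves|` of the comb. [folklore] -/
theorem absSum_combTree (v : ℕ → ℚ) : ∀ k, absSum (combTree v k) = ∑ i ∈ range (k + 1), |v i|
  | 0 => by simp [absSum, combTree, SumTree.leaves]
  | k + 1 => by
      rw [combTree, absSum_node, absSum_combTree v k, sum_range_succ (fun i => |v i|) (k + 1)]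
      simp [absSum, SumTree.leaves]

/-- Exact sum of the comb. [folklore] -/
theorem exact_combTree (v : ℕ → ℚ) : ∀ k, SumTree.exact (combTree v k) = ∑ i ∈ range (k + 1), v i
  | 0 => by simp [combTree, SumTree.exact]
  | k + 1 => by
      rw [combTree, SumTree.exact, exact_combTree v k, sum_range_succ (fun i => v i) (k + 1)]
      rfl

/-- The main chain is the comb over the summands: `eval (comb x k) = ŝₖ` (for `x₀ ∈ F_α`).
[folklore] -/
theorem eval_combTree_eq_kbn_fst (x : ℕ → ℚ) (h0 : ∃ y : MiniFloat α, y.toRat = x 0) :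
    ∀ k, SumTree.eval (flα α) (combTree x k) = (kbn α x k).1
  | 0 => by simp only [combTree, SumTree.eval, kbn]; exact (toRat_roundNE_of_exists h0).symm
  | k + 1 => by
      rw [combTree, SumTree.eval, eval_combTree_eq_kbn_fst x h0 k, kbn_succ]
      rfl

/-- The local errors of the main chain are the corrections: `absErr (comb x n) = Σ_{k<n} |eₖ₊₁|`.
[folklore] -/
theorem absErr_combTree_eq (x : ℕ → ℚ) :
    ∀ n, (∀ i ≤ n, ∃ y : MiniFloat α, y.toRat = x i) →
      absErr (flα α) (combTree x n) = ∑ k ∈ range n, |kbnCorr α x k|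
  | 0, _ => by simp [absErr, SumTree.localErrors, combTree]
  | n + 1, hx => by
      have hx' : ∀ i ≤ n, ∃ y : MiniFloat α, y.toRat = x i := fun i hi => hx i (Nat.le_succ_of_le hi)
      rw [combTree, absErr_node, absErr_combTree_eq x n hx', sum_range_succ,
        eval_combTree_eq_kbn_fst x (hx 0 (Nat.zero_le _)) n, kbnCorr_eq x n (hx (n + 1) le_rfl),
        kbn_succ]
      simp only [SumTree.eval, absErr, SumTree.localErrors, List.map_nil, List.sum_nil, add_zero]
      rw [abs_sub_comm]

/-- The compensation chain is the comb over the corrections: `eval (comb e n) = cₙ₊₁`. [folklore] -/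
theorem eval_combTree_eq_kbn_snd (x : ℕ → ℚ) :
    ∀ n, SumTree.eval (flα α) (combTree (kbnCorr α x) n) = (kbn α x (n + 1)).2
  | 0 => by
      simp only [combTree, SumTree.eval, kbn, zero_add]
      exact (toRat_roundNE_of_exists (exists_toRat_eq_kbnCorr x 0)).symm
  | n + 1 => by
      rw [combTree, SumTree.eval, eval_combTree_eq_kbn_snd x n, kbn_succ x (n + 1)]
      rfl

/-! ### (iii), (iv): the Jeannerod–Rump bound on both chains -/

/-- (iii) `Σ_{k<n} |eₖ₊₁| ≤ n · u/(1+u) · Σ_{i≤n} |xᵢ|` — the local errors of recursive summation,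
bounded by the any-order theorem for the format. [cite: JeannerodRump2018, Thm 4.1] -/
theorem sum_abs_kbnCorr_le (hα : 2 ≤ α.emaxCode) (x : ℕ → ℚ) (n : ℕ)
    (hx : ∀ i ≤ n, ∃ y : MiniFloat α, y.toRat = x i)
    (hr : ∀ k < n, |(kbn α x k).1 + x (k + 1)| ≤ α.maxRat) :
    ∑ k ∈ range n, |kbnCorr α x k|
      ≤ n * (α.unitRoundoff / (1 + α.unitRoundoff)) * ∑ i ∈ range (n + 1), |x i| := by
  have hrange : ∀ k ≤ n, TreeInRange α (combTree x k) := by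
    intro k hk
    induction k with
    | zero => exact hx 0 (Nat.zero_le _)
    | succ j ih =>
        refine ⟨ih (Nat.le_of_succ_le hk), hx (j + 1) hk, ?_⟩
        rw [eval_combTree_eq_kbn_fst x (hx 0 (Nat.zero_le _)) j]
        exact hr j (Nat.lt_of_succ_le hk)
  have h := absErr_flα_le hα (combTree x n) (hrange n le_rfl)
  rw [absErr_combTree_eq x n hx, absSum_combTree, length_leaves_combTree] at h
  push_cast at h
  simpa using h

/-- (iv) `|cₙ - Σ_{k<n} eₖ₊₁| ≤ (n-1) · u/(1+u) · Σ_{k<n} |eₖ₊₁|`: the compensation chain is itself a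
recursive floating-point sum of the `n` values `eₖ`. [cite: JeannerodRump2018, Thm 4.1] -/
theorem abs_kbn_snd_sub_sum_corr_le (hα : 2 ≤ α.emaxCode) (x : ℕ → ℚ) (n : ℕ)
    (hr : ∀ k < n, |(kbn α x k).2 + kbnCorr α x k| ≤ α.maxRat) :
    |(kbn α x n).2 - ∑ k ∈ range n, kbnCorr α x k|
      ≤ ((n : ℚ) - 1) * (α.unitRoundoff / (1 + α.unitRoundoff)) * ∑ k ∈ range n, |kbnCorr α x k| := by
  cases n with
  | zero => simp [kbn]
  | succ m =>
      have hrange : ∀ k ≤ m, TreeInRange α (combTree (kbnCorr α x) k) := by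
        intro k hk
        induction k with
        | zero => exact exists_toRat_eq_kbnCorr x 0
        | succ j ih =>
            refine ⟨ih (Nat.le_of_succ_le hk), exists_toRat_eq_kbnCorr x (j + 1), ?_⟩
            rw [eval_combTree_eq_kbn_snd x j]
            exact hr (j + 1) (Nat.succ_lt_succ (Nat.lt_of_succ_le hk))
      have h := abs_eval_sub_exact_le_sharp hα (combTree (kbnCorr α x) m) (hrange m le_rfl)
      rw [eval_combTree_eq_kbn_snd x m, exact_combTree, absSum_combTree, length_leaves_combTree] at h
      push_cast at h
      simpa using h

/-! ### (v) The envelope -/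

/-- (v) NEUMAIER SUMMATION, SHARP FORM: for `x₀ … xₙ ∈ F_α` (`emaxCode α ≥ 2`) with no chain sum
out of range, `|res - s| ≤ u'·|s| + (1 + u')·n(n-1)·u'²·Σ|xᵢ|`, `u' = u/(1+u)`, `s = Σ xᵢ`.
[cite: BoldoEtAl2023, §5.3 (Neumaier1974)] -/
theorem abs_kbnSum_sub_sum_le_sharp (hα : 2 ≤ α.emaxCode) (x : ℕ → ℚ) (n : ℕ)
    (hx : ∀ i ≤ n, ∃ y : MiniFloat α, y.toRat = x i)
    (hr1 : ∀ k < n, |(kbn α x k).1 + x (k + 1)| ≤ α.maxRat)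
    (hr2 : ∀ k < n, |(kbn α x k).2 + kbnCorr α x k| ≤ α.maxRat)
    (hr3 : |(kbn α x n).1 + (kbn α x n).2| ≤ α.maxRat) :
    |kbnSum α x n - ∑ i ∈ range (n + 1), x i|
      ≤ α.unitRoundoff / (1 + α.unitRoundoff) * |∑ i ∈ range (n + 1), x i|
        + (1 + α.unitRoundoff / (1 + α.unitRoundoff)) * ((n : ℚ) * (n - 1))
          * (α.unitRoundoff / (1 + α.unitRoundoff)) ^ 2 * ∑ i ∈ range (n + 1), |x i| := by
  set u' := α.unitRoundoff / (1 + α.unitRoundoff) with hu'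
  have hupos := α.unitRoundoff_pos
  have hu'0 : 0 ≤ u' := div_nonneg hupos.le (by linarith)
  set s := ∑ i ∈ range (n + 1), x i with hs
  set L := ∑ i ∈ range (n + 1), |x i| with hL
  set E := ∑ k ∈ range n, kbnCorr α x k with hE
  set Eabs := ∑ k ∈ range n, |kbnCorr α x k| with hEabs
  have hL0 : 0 ≤ L := sum_nonneg fun _ _ => abs_nonneg _
  -- the pieces
  have h2 : (kbn α x n).1 + E = s := kbn_fst_add_sum_corr x n hx
  have h3 : Eabs ≤ n * u' * L := sum_abs_kbnCorr_le hα x n hx hr1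
  have h4 : |(kbn α x n).2 - E| ≤ ((n : ℚ) - 1) * u' * Eabs := abs_kbn_snd_sub_sum_corr_le hα x n hr2
  obtain ⟨ys, hys⟩ := exists_toRat_eq_kbn_fst (α := α) x n
  obtain ⟨yc, hyc⟩ := exists_toRat_eq_kbn_snd (α := α) x n
  have h5 : |kbnSum α x n - ((kbn α x n).1 + (kbn α x n).2)| ≤ u' * |(kbn α x n).1 + (kbn α x n).2| := by
    have := abs_err_roundNE_add_le_sharp hα ys yc (by rw [hys, hyc]; exact hr3)
    rw [hys, hyc] at this
    exact this
  -- D := cₙ - Σe, |D| ≤ (n-1) n u'² L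
  set D := (kbn α x n).2 - E with hD
  have hDle : |D| ≤ ((n : ℚ) * (n - 1)) * u' ^ 2 * L := by
    rcases Nat.eq_zero_or_pos n with hn | hn
    · subst hn; simp [hD, hE, kbn]
    · have hn1 : (1 : ℚ) ≤ n := by exact_mod_cast hn
      calc |D| ≤ ((n : ℚ) - 1) * u' * Eabs := h4
        _ ≤ ((n : ℚ) - 1) * u' * (n * u' * L) :=
            mul_le_mul_of_nonneg_left h3 (mul_nonneg (by linarith) hu'0)
        _ = ((n : ℚ) * (n - 1)) * u' ^ 2 * L := by ring
  have hsum : (kbn α x n).1 + (kbn α x n).2 = s + D := by rw [hD, ← h2]; ring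
  rw [hsum] at h5
  have hkey : kbnSum α x n - s = (kbnSum α x n - (s + D)) + D := by ring
  rw [hkey]
  calc |kbnSum α x n - (s + D) + D| ≤ |kbnSum α x n - (s + D)| + |D| := abs_add_le _ _
    _ ≤ u' * |s + D| + |D| := by linarith
    _ ≤ u' * (|s| + |D|) + |D| := by linarith [mul_le_mul_of_nonneg_left (abs_add_le s D) hu'0]
    _ = u' * |s| + (1 + u') * |D| := by ring
    _ ≤ u' * |s| + (1 + u') * (((n : ℚ) * (n - 1)) * u' ^ 2 * L) := by
        have : 0 ≤ 1 + u' := by linarith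
        nlinarith
    _ = u' * |s| + (1 + u') * ((n : ℚ) * (n - 1)) * u' ^ 2 * L := by ring

/-- `(1 + u')·u'² ≤ u²` for `u' = u/(1+u)`, `u ≥ 0`. [folklore] -/
theorem one_add_mul_sq_sharp_le (u : ℚ) (hu : 0 ≤ u) :
    (1 + u / (1 + u)) * (u / (1 + u)) ^ 2 ≤ u ^ 2 := by
  have h1 : 0 < 1 + u := by linarith
  have e : (1 + u / (1 + u)) * (u / (1 + u)) ^ 2 = u ^ 2 * ((1 + 2 * u) / (1 + u) ^ 3) := by
    field_simp
    ring
  rw [e]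
  have h2 : (1 + 2 * u) / (1 + u) ^ 3 ≤ 1 := by
    rw [div_le_one (by positivity)]
    nlinarith [mul_nonneg hu hu, mul_nonneg (mul_nonneg hu hu) hu]
  calc u ^ 2 * ((1 + 2 * u) / (1 + u) ^ 3) ≤ u ^ 2 * 1 := mul_le_mul_of_nonneg_left h2 (by positivity)
    _ = u ^ 2 := mul_one _


/-- NEUMAIER SUMMATION IN A MINIFLOAT FORMAT — THE ENVELOPE: for summands `x₀ … xₙ ∈ F_α`
(`emaxCode α ≥ 2`) and no chain sum out of range,
`|res - Σxᵢ| ≤ u·|Σxᵢ| + n(n-1)·u²·Σ|xᵢ|` (`n + 1` summands, `n` additions in each chain; no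
condition on `n·u`). [cite: BoldoEtAl2023, §5.3 (Neumaier1974; OgitaRumpOishi2005)] -/
theorem abs_kbnSum_sub_sum_le (hα : 2 ≤ α.emaxCode) (x : ℕ → ℚ) (n : ℕ)
    (hx : ∀ i ≤ n, ∃ y : MiniFloat α, y.toRat = x i)
    (hr1 : ∀ k < n, |(kbn α x k).1 + x (k + 1)| ≤ α.maxRat)
    (hr2 : ∀ k < n, |(kbn α x k).2 + kbnCorr α x k| ≤ α.maxRat)
    (hr3 : |(kbn α x n).1 + (kbn α x n).2| ≤ α.maxRat) :
    |kbnSum α x n - ∑ i ∈ range (n + 1), x i|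
      ≤ α.unitRoundoff * |∑ i ∈ range (n + 1), x i|
        + ((n : ℚ) * (n - 1)) * α.unitRoundoff ^ 2 * ∑ i ∈ range (n + 1), |x i| := by
  have h := abs_kbnSum_sub_sum_le_sharp hα x n hx hr1 hr2 hr3
  have hu := α.unitRoundoff_pos
  set u := α.unitRoundoff
  have hL0 : 0 ≤ ∑ i ∈ range (n + 1), |x i| := sum_nonneg fun _ _ => abs_nonneg _
  have hS0 := abs_nonneg (∑ i ∈ range (n + 1), x i)
  have h1 : u / (1 + u) ≤ u := by rw [div_le_iff₀ (by linarith)]; nlinarith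
  have h2 := one_add_mul_sq_sharp_le u hu.le
  have hnn : (0 : ℚ) ≤ (n : ℚ) * (n - 1) := by
    rcases Nat.eq_zero_or_pos n with hn | hn
    · subst hn; simp
    · have : (1 : ℚ) ≤ n := by exact_mod_cast hn
      nlinarith
  refine le_trans h ?_
  have e : (1 + u / (1 + u)) * ((n : ℚ) * (n - 1)) * (u / (1 + u)) ^ 2 * ∑ i ∈ range (n + 1), |x i|
      = ((n : ℚ) * (n - 1)) * ((1 + u / (1 + u)) * (u / (1 + u)) ^ 2) * ∑ i ∈ range (n + 1), |x i| := by
    ring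
  rw [e]
  apply add_le_add
  · exact mul_le_mul_of_nonneg_right h1 hS0
  · exact mul_le_mul_of_nonneg_right (mul_le_mul_of_nonneg_left h2 hnn) hL0

/-- The classical second-order form: with `n·u < 1`, `|res - Σxᵢ| ≤ u·|Σxᵢ| + γₙ²·Σ|xᵢ|`
(`γₙ = nu/(1-nu)`; for `n + 1` summands this is the cell's GEMM-note Prop. kbn (iv) with its
`γ_{N-1}`, `N = n + 1`). [cite: BoldoEtAl2023, §5.3 (OgitaRumpOishi2005)] -/
theorem abs_kbnSum_sub_sum_le_gamma (hα : 2 ≤ α.emaxCode) (x : ℕ → ℚ) (n : ℕ)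
    (hn : (n : ℚ) * α.unitRoundoff < 1)
    (hx : ∀ i ≤ n, ∃ y : MiniFloat α, y.toRat = x i)
    (hr1 : ∀ k < n, |(kbn α x k).1 + x (k + 1)| ≤ α.maxRat)
    (hr2 : ∀ k < n, |(kbn α x k).2 + kbnCorr α x k| ≤ α.maxRat)
    (hr3 : |(kbn α x n).1 + (kbn α x n).2| ≤ α.maxRat) :
    |kbnSum α x n - ∑ i ∈ range (n + 1), x i|
      ≤ α.unitRoundoff * |∑ i ∈ range (n + 1), x i|
        + Higham2002.gamma α.unitRoundoff n ^ 2 * ∑ i ∈ range (n + 1), |x i| := by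
  have h := abs_kbnSum_sub_sum_le hα x n hx hr1 hr2 hr3
  have hu := α.unitRoundoff_pos
  set u := α.unitRoundoff
  have hL0 : 0 ≤ ∑ i ∈ range (n + 1), |x i| := sum_nonneg fun _ _ => abs_nonneg _
  refine le_trans h (add_le_add le_rfl (mul_le_mul_of_nonneg_right ?_ hL0))
  -- n(n-1) u² ≤ (nu)² ≤ γₙ²
  have hn0 : (0 : ℚ) ≤ n := by positivity
  have hg : (n : ℚ) * u ≤ Higham2002.gamma u n := by
    unfold Higham2002.gamma
    rw [le_div_iff₀ (by linarith)]
    nlinarith [mul_nonneg hn0 hu.le]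
  calc (n : ℚ) * (n - 1) * u ^ 2 ≤ ((n : ℚ) * u) ^ 2 := by nlinarith [mul_nonneg hn0 (mul_nonneg hu.le hu.le)]
    _ ≤ Higham2002.gamma u n ^ 2 := pow_le_pow_left₀ (mul_nonneg hn0 hu.le) hg 2

/-! ### Kernel illustration -/

/-- `bfloat16` (`u = 2^-8`), summands `1, u, u, u, u` — the Lange–Rump witness of `Accumulate.lean`,
on which plain recursive summation never moves off `1` (every `1 + u` ties to even): Neumaier's
scheme carries the lost `u`'s exactly in `c` and returns `fl(1 + 4u) = 1 + 1/64`, the EXACT sum,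
where recursive summation returns `1` (error `4u`); after three `u`'s it returns `1 + 1/64`, the
correctly rounded value of the non-representable exact sum `1 + 3u` (error `u`, vs `3u`). [folklore] -/
theorem kbnSum_BFloat16_witness :
    kbnSum Format.BFloat16 (fun i => if i = 0 then 1 else 1 / 256) 4 = 1 + 1 / 64 ∧
    (seqSum Format.BFloat16 (fun i => if i = 0 then 1 else 1 / 256) 4).toRat = 1 ∧
    kbnSum Format.BFloat16 (fun i => if i = 0 then 1 else 1 / 256) 3 = 1 + 1 / 64 := by
  decide +kernel

end MiniFloat

end Literature.ComputerArithmetic.FloatingPoint
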